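import Summits.Ventures.PercRepro.RankLevelSetRuleQFullUniformCell

/-!
# PercRepro — THE EXACT TABLE: FOR `3 ≤ k ≤ 20`, THE CELLS `(q+k, q)` WITH (R̂) ON THEIR WHOLE UNTRUNCATED REGIME FROM THE TOP
INEQUALITY, AND THE SHARPNESS OF THE TABLE (p4, gen 23; C-044; paper proofs/P4-CELL-THREE.md §12.5.2)

`qmax = [10, 18, 27, 37, 49, 61, 75, 90, 106, 123, 141, 160, 181, 202, 224, 248, 272, 297]` for `k = 3 … 20`:
`rhat_cells_table` — every cell `(q+k, q)` with `k ≤ q ≤ qmax(k)` has `Φ(q+k, q) ≤ R̂(q, k, m)` for every `m ≤ q − k + 1`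
(2,132 top inequalities in one kernel `decide`); `top_fails_beyond_table` — at `q = qmax(k) + 1` the top inequality FAILS for
every `k` (so the table is exact for Theorem C's hypothesis; whether (R̂) itself holds on those cells is the open band).
No defs; axioms standard.
-/

namespace PercRepro

open Finset

/-- **The exact table**: `3 ≤ k ≤ 20`, `k ≤ q ≤ qmax(k)` — (R̂) on the whole untruncated regime of every such cell. -/
theorem rhat_cells_table : ∀ k ∈ Finset.Icc 3 20,
    ∀ q ∈ Finset.Icc k ([10, 18, 27, 37, 49, 61, 75, 90, 106, 123, 141, 160, 181, 202, 224, 248, 272, 297].getD (k - 3) 0),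
    ∀ m, m ≤ q - k + 1 → phiK (q + k) q ≤ rhat q k m := by
  have h : ∀ k ∈ Finset.Icc 3 20,
      ∀ q ∈ Finset.Icc k ([10, 18, 27, 37, 49, 61, 75, 90, 106, 123, 141, 160, 181, 202, 224, 248, 272, 297].getD (k - 3) 0),
      (q + 1) * ((q - k + 1).choose k + (2 * k - 1).choose k) ≤ k * (q + k).choose k := by
    simp only [Nat.choose_eq_descFactorial_div_factorial]
    decide +kernel
  intro k hk q hq
  have hk' := Finset.mem_Icc.1 hk
  have hq' := Finset.mem_Icc.1 hq
  exact rhat_cell_all_of_top q k hk'.1 hq'.1 (h k hk q hq)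

/-- **Sharpness of the table**: at `q = qmax(k) + 1` the top inequality fails, for every `3 ≤ k ≤ 20`. -/
theorem top_fails_beyond_table : ∀ k ∈ Finset.Icc 3 20,
    ¬ ((([10, 18, 27, 37, 49, 61, 75, 90, 106, 123, 141, 160, 181, 202, 224, 248, 272, 297].getD (k - 3) 0 + 1) + 1)
        * ((([10, 18, 27, 37, 49, 61, 75, 90, 106, 123, 141, 160, 181, 202, 224, 248, 272, 297].getD (k - 3) 0 + 1) - k + 1).choose k
            + (2 * k - 1).choose k)
      ≤ k * (([10, 18, 27, 37, 49, 61, 75, 90, 106, 123, 141, 160, 181, 202, 224, 248, 272, 297].getD (k - 3) 0 + 1) + k).choose k) := by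
  simp only [Nat.choose_eq_descFactorial_div_factorial]
  decide +kernel

end PercRepro
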